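import Summits.QuantumFields.YangMills.Theorems.BalabanUVNodesN15KingModelTorusMassGap
import Literature.Combinatorics.SimpleGraph.CycleSpectrum
import Literature.MathematicalPhysics.QuantumLattice.InfiniteVolumeChainRegionProofs
import HarnessLib

/-!
# BalabanUVNodes ∕ N15 — THE KING-MODEL RUNG (PART Ϲ-e): THE RELATIVISTIC DISPERSION RELATION IN THE CONTINUUM LIMIT, WITH ITS η-RATE —
# the energy per unit length of the timeslice channel of physical momentum `P`, `E_N(P) = N·latticeMass(m²∕N² + Σ_μ(2 − 2cos(P_μ∕N)))`, satisfies
# `0 ≤ √(m² + |P|²) − E_N(P) ≤ (Σ_μ P_μ⁴∕(12√(m²+|P|²)) + (m²+|P|²)^{3∕2}∕24)∕N²` inside the Brillouin zone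
# (Track A, DAG node N15 = NE2 «η-rates of the covariance pieces»; FAN-OUT v1.1 §N15 s3 «KING-MODEL RUNG»; count-neutral)

HONEST FRAMING.  Count-neutral (cell `pub-ymgap`, seat `pub-ymgap-dag-n15-e` g38; `--supports stmt-QuantumFields-27366 --as helper` = K3⁸).
TEMPLATE LITERATURE: C. King, Commun. Math. Phys. **102** (1986) 649–677 [King1986] — King's OWN `A = 0` free operator in King's units
(`lapF (fine N M) N² m²`, (4.4) p.670): by PART Ϲ-b (`timeSlice_chi_lapF_inv_eq_cycleGreen`) the timeslice channel of the fine momentum `p`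
(`p_κ = 0`) decays per fine step at `ω_p = latticeMass(lapSym(p)∕N²)`, and `lapSym(p)∕N² = m²∕N² + Σ_μ(2 − 2cos(P_μ∕N))` with the PHYSICAL
(unit-lattice) momentum `P_μ = 2π·valMinAbs(p_μ)∕M_μ` (§1).  Montvay–Münster [MontvayMunster1994] §2.2.1: `cosh ω₀(p) = 1 + ½(m₀² + p̂²)`,
`p̂_μ = 2 sin(p_μ∕2)` (2.71)–(2.75), `ω₀(p) = m̄₀ + p²∕2m₀* + …` (2.77) and, reintroducing the lattice spacing, `m̄₀ = m₀{1 + O(a²m₀²)}` (2.82).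
THIS FILE proves the `O(a²)` statement for the WHOLE one-particle energy: per unit length, `E_N(P) = N·ω` converges to the RELATIVISTIC energy
`√(m² + |P|²)` from below at rate `η² = N^{−2}`, with an explicit constant, for every momentum in the Brillouin zone `|P_μ| ≤ πN` — the Euclidean
(lattice) rotation∕Lorentz symmetry of the one-particle dispersion is restored in King's continuum limit at rate `η²`.  NOT Bałaban's covariant
objects; NOT a node discharge (N15 is booked through n15-a's knit, untouched); nothing continuum-YM ∕ ℝ⁴ ∕ OS axioms ∕ Clay.  0 `sorry`, 0 `def`.

WHAT THIS FILE PROVES (kernel).  §1 `lapSym_fine_div_sq` (King's units: `lapSym(p)∕N² = m²∕N² + Σ_μ(2 − 2cos(P_μ∕N))`; the cosine bounds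
`u² − u⁴∕12 ≤ 2 − 2cos u ≤ u²` are REUSED from the tree: `Literature.Combinatorics.SimpleGraph.sq_sub_pow_four_div_twelve_le`,
`Literature.MathematicalPhysics.QuantumLattice.two_sub_two_mul_cos_le_sq`).  §2 `sq_mul_latticeArg_le`, `sub_le_sq_mul_latticeArg`, ★★ `latticeEnergy_le`
(`E_N(P) ≤ √(m² + |P|²)`), ★★★ **`relativistic_sub_latticeEnergy_le`** (`√(m²+|P|²) − E_N(P) ≤ (Σ_μP_μ⁴∕(12√(m²+|P|²)) + (m²+|P|²)^{3∕2}∕24)∕N²` for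
`|P_μ| ≤ πN`), ★★★ **`latticeEnergy_eta_rate`** (both sides), ★★ `tendsto_latticeEnergy` (`E_N(P) → √(m² + |P|²)`).

HONEST SCOPE.  Real analysis of King's free dispersion relation in King's units; `m² > 0`; momenta in the Brillouin zone for the lower bound.  The
identification with an actual channel of `B⁻¹` on a given torus is PART Ϲ-b plus §1's `lapSym_fine_div_sq`; the limit is along `N → ∞` at FIXED
physical momentum `P` (a formula-level statement: the fine tori change with `N`).  N15 untouched; counts unmoved.
Locators: [King1986] (4.4) p.670; [MontvayMunster1994] §2.2.1 (2.71)–(2.77), (2.82); [DrouffeZuber1983] (3.46) p.41.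
-/

noncomputable section

open scoped BigOperators Topology
open Finset Real Filter

namespace Summit.QuantumFields.YangMills.BalabanUVNodes.N15KingModelRung.TorusSpectral

open Literature.MathematicalPhysics.QuantumFieldTheory.Balaban1983to89.B5Prop11Plancherel
open Literature.MathematicalPhysics.QuantumFieldTheory.King1986.Torus
open Literature.MathematicalPhysics.QuantumLattice (two_sub_two_mul_cos_le_sq)
open Literature.Combinatorics.SimpleGraph (sq_sub_pow_four_div_twelve_le)

/-! ## §1 King's symbol in King's units (the elementary bounds `u² − u⁴∕12 ≤ 2 − 2cos u ≤ u²` are the tree's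
`Literature.Combinatorics.SimpleGraph.sq_sub_pow_four_div_twelve_le` ∕ `Literature.MathematicalPhysics.QuantumLattice.two_sub_two_mul_cos_le_sq`) -/

section Cosine

variable {d : ℕ} (N : ℕ) [NeZero N] (M : Fin d → ℕ) [hM : ∀ μ, NeZero (M μ)]

/-- KING's UNITS: for a fine momentum `p ∈ Tor(Ω_η)`, `lapSym(p)∕N² = m²∕N² + Σ_μ(2 − 2cos(P_μ∕N))` with the PHYSICAL momentum
`P_μ = 2π·valMinAbs(p_μ)∕M_μ` (the reduced fine momentum is `p′_μ = P_μ∕N`). [cite: King1986, (4.4) p.670] -/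
theorem lapSym_fine_div_sq (m2 : ℝ) (p : Tor (fine N M)) :
    lapSym (fine N M) ((N : ℝ) ^ 2) m2 p / (N : ℝ) ^ 2
      = m2 / (N : ℝ) ^ 2 + ∑ μ : Fin d, (2 - 2 * Real.cos ((2 * Real.pi * ((p μ).valMinAbs : ℝ) / (M μ : ℝ)) / N)) := by
  have hN : (N : ℝ) ≠ 0 := by exact_mod_cast NeZero.ne N
  unfold lapSym
  have hs : ∀ μ : Fin d, sOf (fine N M) p μ = (2 * Real.pi * ((p μ).valMinAbs : ℝ) / (M μ : ℝ)) / N := by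
    intro μ
    unfold sOf
    have : ((fine N M μ : ℕ) : ℝ) = (N : ℝ) * M μ := by
      show (((N * M μ : ℕ)) : ℝ) = (N : ℝ) * M μ
      push_cast; ring
    rw [this]
    have hM0 : (M μ : ℝ) ≠ 0 := by exact_mod_cast NeZero.ne (M μ)
    field_simp
  simp_rw [hs]
  field_simp

end Cosine

/-! ## §2 The η-rate of the one-particle energy: `E_N(P) → √(m² + |P|²)` at rate `N^{−2}` -/

section Dispersion

variable {ι : Type*} [Fintype ι] (P : ι → ℝ) {m2 : ℝ}

/-- `N²·(m²∕N² + Σ_μ(2 − 2cos(P_μ∕N))) ≤ m² + Σ_μ P_μ²`. [folklore] -/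
theorem sq_mul_latticeArg_le {N : ℝ} (hN : 0 < N) (m2 : ℝ) :
    N ^ 2 * (m2 / N ^ 2 + ∑ μ, (2 - 2 * Real.cos (P μ / N))) ≤ m2 + ∑ μ, P μ ^ 2 := by
  have h : ∀ μ, N ^ 2 * (2 - 2 * Real.cos (P μ / N)) ≤ P μ ^ 2 := by
    intro μ
    have := two_sub_two_mul_cos_le_sq (P μ / N)
    have e : N ^ 2 * (P μ / N) ^ 2 = P μ ^ 2 := by field_simp
    nlinarith [e, sq_nonneg N]
  rw [mul_add, mul_div_cancel₀ _ (by positivity), Finset.mul_sum]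
  linarith [Finset.sum_le_sum fun μ (_ : μ ∈ Finset.univ) => h μ]

/-- `m² + Σ_μ P_μ² − Σ_μ P_μ⁴∕(12N²) ≤ N²·(m²∕N² + Σ_μ(2 − 2cos(P_μ∕N)))`. [folklore] -/
theorem sub_le_sq_mul_latticeArg {N : ℝ} (hN : 0 < N) (m2 : ℝ) :
    m2 + ∑ μ, P μ ^ 2 - (∑ μ, P μ ^ 4) / (12 * N ^ 2) ≤ N ^ 2 * (m2 / N ^ 2 + ∑ μ, (2 - 2 * Real.cos (P μ / N))) := by
  have h : ∀ μ, P μ ^ 2 - P μ ^ 4 / (12 * N ^ 2) ≤ N ^ 2 * (2 - 2 * Real.cos (P μ / N)) := by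
    intro μ
    have := sq_sub_pow_four_div_twelve_le (P μ / N)
    have e1 : N ^ 2 * (P μ / N) ^ 2 = P μ ^ 2 := by field_simp
    have e2 : N ^ 2 * ((P μ / N) ^ 4 / 12) = P μ ^ 4 / (12 * N ^ 2) := by field_simp
    nlinarith [e1, e2, sq_nonneg N]
  rw [mul_add, mul_div_cancel₀ _ (by positivity), Finset.mul_sum, Finset.sum_div]
  have := Finset.sum_le_sum fun μ (_ : μ ∈ Finset.univ) => h μ
  rw [Finset.sum_sub_distrib] at this
  linarith

/-- ★★ **`E_N(P) ≤ √(m² + |P|²)`** — the lattice one-particle energy per unit length never exceeds the relativistic one (`m² ≥ 0`, `N > 0`).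
[cite: MontvayMunster1994, §2.2.1 (2.74)–(2.77)] -/
theorem latticeEnergy_le {N : ℝ} (hN : 0 < N) (hm : 0 ≤ m2) :
    N * latticeMass (m2 / N ^ 2 + ∑ μ, (2 - 2 * Real.cos (P μ / N))) ≤ Real.sqrt (m2 + ∑ μ, P μ ^ 2) := by
  have hx : 0 ≤ m2 / N ^ 2 + ∑ μ, (2 - 2 * Real.cos (P μ / N)) := by
    have : ∀ μ, 0 ≤ 2 - 2 * Real.cos (P μ / N) := fun μ => by have := Real.cos_le_one (P μ / N); linarith
    exact add_nonneg (div_nonneg hm (sq_nonneg N)) (Finset.sum_nonneg fun μ _ => this μ)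
  set x := m2 / N ^ 2 + ∑ μ, (2 - 2 * Real.cos (P μ / N))
  calc N * latticeMass x ≤ N * Real.sqrt x := mul_le_mul_of_nonneg_left (latticeMass_le_sqrt x) hN.le
    _ = Real.sqrt (N ^ 2 * x) := by rw [Real.sqrt_mul' _ hx, Real.sqrt_sq hN.le]
    _ ≤ Real.sqrt (m2 + ∑ μ, P μ ^ 2) := Real.sqrt_le_sqrt (sq_mul_latticeArg_le P hN m2)

/-- `√(E² − δ) ≥ E − δ∕E` for `0 ≤ δ ≤ E²`, `E > 0`. [folklore] -/
theorem sub_div_le_sqrt_sq_sub {E δ : ℝ} (hE : 0 < E) (hδ : 0 ≤ δ) (hδE : δ ≤ E ^ 2) :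
    E - δ / E ≤ Real.sqrt (E ^ 2 - δ) := by
  have h0 : 0 ≤ E - δ / E := by
    rw [sub_nonneg, div_le_iff₀ hE]; nlinarith
  rw [← Real.sqrt_sq h0]
  apply Real.sqrt_le_sqrt
  have : (E - δ / E) ^ 2 = E ^ 2 - 2 * δ + δ ^ 2 / E ^ 2 := by field_simp; ring
  rw [this]
  have : δ ^ 2 / E ^ 2 ≤ δ := by
    rw [div_le_iff₀ (by positivity)]; nlinarith
  linarith

/-- ★★★ **THE η-RATE OF THE ONE-PARTICLE ENERGY (upper side)**: inside the Brillouin zone (`|P_μ| ≤ πN`), with `E = √(m² + |P|²)` and `m² > 0`,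
`E − N·latticeMass(m²∕N² + Σ_μ(2 − 2cos(P_μ∕N))) ≤ (Σ_μ P_μ⁴∕(12E) + E³∕24)∕N²` — the lattice dispersion relation converges to the RELATIVISTIC one
`E(P) = √(m² + |P|²)` at rate `η² = N^{−2}` (Montvay–Münster's `O(a²)` with the constant, for the whole energy–momentum relation).
[cite: MontvayMunster1994, §2.2.1 (2.74)–(2.77), (2.82); DrouffeZuber1983, (3.46) p.41] -/
theorem relativistic_sub_latticeEnergy_le {N : ℝ} (hN : 0 < N) (hm : 0 < m2) (hP : ∀ μ, |P μ| ≤ Real.pi * N) :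
    Real.sqrt (m2 + ∑ μ, P μ ^ 2) - N * latticeMass (m2 / N ^ 2 + ∑ μ, (2 - 2 * Real.cos (P μ / N)))
      ≤ ((∑ μ, P μ ^ 4) / (12 * Real.sqrt (m2 + ∑ μ, P μ ^ 2)) + Real.sqrt (m2 + ∑ μ, P μ ^ 2) ^ 3 / 24) / N ^ 2 := by
  set E := Real.sqrt (m2 + ∑ μ, P μ ^ 2) with hEdef
  set x := m2 / N ^ 2 + ∑ μ, (2 - 2 * Real.cos (P μ / N)) with hxdef
  set δ := (∑ μ, P μ ^ 4) / (12 * N ^ 2) with hδdef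
  have hE2pos : 0 < m2 + ∑ μ, P μ ^ 2 := by positivity
  have hE : 0 < E := Real.sqrt_pos.mpr hE2pos
  have hEsq : E ^ 2 = m2 + ∑ μ, P μ ^ 2 := Real.sq_sqrt hE2pos.le
  have hx : 0 ≤ x := by
    have : ∀ μ, 0 ≤ 2 - 2 * Real.cos (P μ / N) := fun μ => by have := Real.cos_le_one (P μ / N); linarith
    rw [hxdef]
    exact add_nonneg (div_nonneg hm.le (sq_nonneg N)) (Finset.sum_nonneg fun μ _ => this μ)
  have hδ : 0 ≤ δ := by
    rw [hδdef]
    exact div_nonneg (Finset.sum_nonneg fun μ _ => by positivity) (by positivity)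
  -- `δ ≤ E²`: in the Brillouin zone `P_μ⁴∕(12N²) ≤ (π²∕12)P_μ² ≤ P_μ²`
  have hδE : δ ≤ E ^ 2 := by
    rw [hEsq, hδdef, div_le_iff₀ (by positivity)]
    have hterm : ∀ μ, P μ ^ 4 ≤ P μ ^ 2 * (12 * N ^ 2) := by
      intro μ
      have h1 : P μ ^ 2 ≤ (Real.pi * N) ^ 2 := by
        have := hP μ
        have h0 : 0 ≤ Real.pi * N := by positivity
        nlinarith [abs_nonneg (P μ), sq_abs (P μ)]
      have hpi : Real.pi ^ 2 ≤ 12 := by nlinarith [Real.pi_lt_d2, Real.pi_pos]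
      have a1 : P μ ^ 2 * P μ ^ 2 ≤ P μ ^ 2 * (Real.pi * N) ^ 2 := mul_le_mul_of_nonneg_left h1 (sq_nonneg _)
      have a2 : (P μ ^ 2 * N ^ 2) * Real.pi ^ 2 ≤ (P μ ^ 2 * N ^ 2) * 12 := mul_le_mul_of_nonneg_left hpi (by positivity)
      nlinarith [a1, a2]
    have hsum := Finset.sum_le_sum fun μ (_ : μ ∈ Finset.univ) => hterm μ
    rw [← Finset.sum_mul] at hsum
    have hP2 : 0 ≤ ∑ μ, P μ ^ 2 := Finset.sum_nonneg fun μ _ => sq_nonneg (P μ)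
    nlinarith [hm.le, hsum, hP2, sq_nonneg N]
  -- lower bound on `N²x` and on `N·ω`
  have hlow : E ^ 2 - δ ≤ N ^ 2 * x := by rw [hEsq]; exact sub_le_sq_mul_latticeArg P hN m2
  have hup : N ^ 2 * x ≤ E ^ 2 := by rw [hEsq]; exact sq_mul_latticeArg_le P hN m2
  have hω := sqrt_sub_le_latticeMass hx
  have hsqrtx : Real.sqrt x = Real.sqrt (N ^ 2 * x) / N := by
    rw [Real.sqrt_mul' _ hx, Real.sqrt_sq hN.le, mul_div_cancel_left₀ _ hN.ne']
  -- `N√x ≥ √(E² − δ) ≥ E − δ∕E` and `N(√x)³∕24 ≤ E³∕(24N²)`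
  have h1 : Real.sqrt (E ^ 2 - δ) ≤ Real.sqrt (N ^ 2 * x) := Real.sqrt_le_sqrt hlow
  have h2 : Real.sqrt (N ^ 2 * x) ≤ E := by
    calc Real.sqrt (N ^ 2 * x) ≤ Real.sqrt (E ^ 2) := Real.sqrt_le_sqrt hup
      _ = E := Real.sqrt_sq hE.le
  have h3 := sub_div_le_sqrt_sq_sub hE hδ hδE
  have hS0 : 0 ≤ Real.sqrt (N ^ 2 * x) := Real.sqrt_nonneg _
  have hcube : N * Real.sqrt x ^ 3 ≤ E ^ 3 / N ^ 2 := by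
    rw [hsqrtx, div_pow, show N * (Real.sqrt (N ^ 2 * x) ^ 3 / N ^ 3) = Real.sqrt (N ^ 2 * x) ^ 3 / N ^ 2 by field_simp]
    exact div_le_div_of_nonneg_right (pow_le_pow_left₀ hS0 h2 3) (by positivity)
  have hmain : E - δ / E - E ^ 3 / (24 * N ^ 2) ≤ N * latticeMass x := by
    have e : N * (Real.sqrt x - Real.sqrt x ^ 3 / 24) ≤ N * latticeMass x := mul_le_mul_of_nonneg_left hω hN.le
    have e2 : N * Real.sqrt x = Real.sqrt (N ^ 2 * x) := by rw [hsqrtx, mul_div_cancel₀ _ hN.ne']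
    have e3 : E ^ 3 / (24 * N ^ 2) = (E ^ 3 / N ^ 2) / 24 := by rw [div_div, mul_comm]
    nlinarith [e, e2, hcube, h1, h3, e3]
  have efin : (∑ μ, P μ ^ 4) / (12 * E) / N ^ 2 + E ^ 3 / 24 / N ^ 2 = δ / E + E ^ 3 / (24 * N ^ 2) := by
    rw [hδdef]; field_simp
  rw [add_div, efin]
  linarith

/-- ★★★ **THE η-RATE OF THE ONE-PARTICLE ENERGY, BOTH SIDES**: `0 ≤ √(m²+|P|²) − E_N(P) ≤ (Σ_μP_μ⁴∕(12√(m²+|P|²)) + (m²+|P|²)^{3∕2}∕24)∕N²`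
for `m² > 0`, `N > 0`, `|P_μ| ≤ πN`. [cite: MontvayMunster1994, §2.2.1 (2.74)–(2.77), (2.82)] -/
theorem latticeEnergy_eta_rate {N : ℝ} (hN : 0 < N) (hm : 0 < m2) (hP : ∀ μ, |P μ| ≤ Real.pi * N) :
    0 ≤ Real.sqrt (m2 + ∑ μ, P μ ^ 2) - N * latticeMass (m2 / N ^ 2 + ∑ μ, (2 - 2 * Real.cos (P μ / N)))
      ∧ Real.sqrt (m2 + ∑ μ, P μ ^ 2) - N * latticeMass (m2 / N ^ 2 + ∑ μ, (2 - 2 * Real.cos (P μ / N)))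
        ≤ ((∑ μ, P μ ^ 4) / (12 * Real.sqrt (m2 + ∑ μ, P μ ^ 2)) + Real.sqrt (m2 + ∑ μ, P μ ^ 2) ^ 3 / 24) / N ^ 2 :=
  ⟨sub_nonneg.mpr (latticeEnergy_le P hN hm.le), relativistic_sub_latticeEnergy_le P hN hm hP⟩

/-- ★★ **`E_N(P) → √(m² + |P|²)`** as `N → ∞` at fixed physical momentum: the relativistic dispersion relation in King's continuum limit.
[cite: MontvayMunster1994, §2.2.1 (2.77), (2.82)] -/
theorem tendsto_latticeEnergy (hm : 0 < m2) :
    Tendsto (fun N : ℕ => ((N + 1 : ℕ) : ℝ) * latticeMass (m2 / ((N + 1 : ℕ) : ℝ) ^ 2 + ∑ μ, (2 - 2 * Real.cos (P μ / ((N + 1 : ℕ) : ℝ)))))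
      atTop (𝓝 (Real.sqrt (m2 + ∑ μ, P μ ^ 2))) := by
  set E := Real.sqrt (m2 + ∑ μ, P μ ^ 2)
  set C := (∑ μ, P μ ^ 4) / (12 * E) + E ^ 3 / 24
  have hup : ∀ N : ℕ, ((N + 1 : ℕ) : ℝ) * latticeMass (m2 / ((N + 1 : ℕ) : ℝ) ^ 2 + ∑ μ, (2 - 2 * Real.cos (P μ / ((N + 1 : ℕ) : ℝ)))) ≤ E :=
    fun N => latticeEnergy_le P (by positivity) hm.le
  -- eventually all `|P_μ| ≤ π(N+1)`
  have hlin : Tendsto (fun N : ℕ => ((N + 1 : ℕ) : ℝ)) atTop atTop := tendsto_natCast_atTop_atTop.comp (tendsto_add_atTop_nat 1)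
  have hev : ∀ᶠ N : ℕ in atTop, ∀ μ, |P μ| ≤ Real.pi * ((N + 1 : ℕ) : ℝ) := by
    refine Filter.eventually_all.mpr fun μ => ?_
    exact (Tendsto.const_mul_atTop Real.pi_pos hlin).eventually_ge_atTop (|P μ|)
  have hlo : ∀ᶠ N : ℕ in atTop, E - C / ((N + 1 : ℕ) : ℝ) ^ 2
      ≤ ((N + 1 : ℕ) : ℝ) * latticeMass (m2 / ((N + 1 : ℕ) : ℝ) ^ 2 + ∑ μ, (2 - 2 * Real.cos (P μ / ((N + 1 : ℕ) : ℝ)))) := by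
    filter_upwards [hev] with N hN
    have := relativistic_sub_latticeEnergy_le P (N := ((N + 1 : ℕ) : ℝ)) (by positivity) hm hN
    linarith
  have hlim : Tendsto (fun N : ℕ => E - C / ((N + 1 : ℕ) : ℝ) ^ 2) atTop (𝓝 E) := by
    have h2 : Tendsto (fun N : ℕ => ((N + 1 : ℕ) : ℝ) ^ 2) atTop atTop := (tendsto_pow_atTop two_ne_zero).comp hlin
    have h3 : Tendsto (fun N : ℕ => C / ((N + 1 : ℕ) : ℝ) ^ 2) atTop (𝓝 0) := tendsto_const_nhds.div_atTop h2
    simpa using tendsto_const_nhds.sub h3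
  exact tendsto_of_tendsto_of_tendsto_of_le_of_le' hlim tendsto_const_nhds hlo (Filter.Eventually.of_forall hup)

end Dispersion

end Summit.QuantumFields.YangMills.BalabanUVNodes.N15KingModelRung.TorusSpectral
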